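import Mathlib
import Summits.NavierStokesRegularity.NavierStokesRegularity.Theorems.TaoLadderRungTwoFlatGaugeCaptureDefs
import HarnessLib

/-!
# The RACE MARGIN left by SPLIT-T48's interface constant `junkThreshold` (kill point (K2) of HOP-INVARIANT-50 §4)
  (helper for stmt-NavierStokesRegularity-23908 `MirrorSolitaryWave` / stmt-…-23909 `GradedAdiabaticWake`; route
  TaoLadderRungTwoFlat; cell harvest/h2-tao-ladder, p1 g21; LADDER §49.4)

The co-moving energy inequality (`…CoMovingEnergyRate/Decay`) decays at rate
`μ_θ = σθ − 2(1+ε)c̄(A·sinh(θ/2) + M·(3 + e^θ))`. The (JB) clause of the filed children bounds the junk energy by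
`junkThreshold ε · (κ/τ)²`, `junkThreshold ε = 3/(8(1+ε)²)` (`MirrorPulse.junkThreshold`), whence the a-priori junk
amplitude `A = √(2·junkThreshold ε)·σ` (`σ = κ/τ`, flat clocks `c̄ = 1`, before the capture-error and template
corrections, `…JunkAmplitude`). This file records, in the kernel, that the constant leaves a POSITIVE margin:

* `two_mul_sqrt_junkThreshold` — `2(1+ε)·√(2·junkThreshold ε) = √3` (the ε-dependence cancels);
* `sinh_half_lt` — `sinh(1/2) < 0.5211` (from `Real.exp_one_lt_d9` / `exp_one_gt_d9`);
* `race_margin_at_one` — at `θ = 1`: `σ·1 − 2(1+ε)·1·(A·sinh(1/2)) = σ(1 − √3·sinh(1/2)) ≥ 0.097·σ > 0`.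

So theory-1's threshold algebra survives at the shell level with margin `≈ 0.0974·σ` for the template (`M`) and
capture-error terms (JUNK-RACE-49 §49.4 reported `0.116·σθ` at `θ = 0.7` with `s(θ) = sinh(0.35)/0.35`; here `θ = 1`).
"Thin but positive of record" (HOP-INVARIANT-50 (K2)).

HONEST FRAMING: elementary numerics about the cell's MODEL-lattice constants; nothing certified about any orbit;
nothing about the Navier–Stokes equations.
-/

noncomputable section

-- the sub-problem namespace repeats the summit name by design (D-0017)
set_option linter.dupNamespace false

namespace Summit.NavierStokesRegularity.NavierStokesRegularity.Theorems

namespace MirrorPulse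

/-- `2(1+ε)·√(2·junkThreshold ε) = √3` for `ε > −1`: the junk amplitude allowed by (JB) is `√3·σ/(2(1+ε))`, and
the flux constant `2(1+ε)` of the race cancels the `ε`-dependence. [cite: Tao2016AveragedNS, §4 (4.3); route
TaoLadderRungTwoFlat, SPLIT-T48 interface constant (LADDER §48.3, §49.4)] -/
theorem two_mul_sqrt_junkThreshold {ε : ℝ} (hε : -1 < ε) :
    2 * (1 + ε) * Real.sqrt (2 * junkThreshold ε) = Real.sqrt 3 := by
  unfold junkThreshold
  have h1 : 0 < 1 + ε := by linarith
  have e : 2 * (3 / (8 * (1 + ε) ^ 2)) = (Real.sqrt 3 / (2 * (1 + ε))) ^ 2 := by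
    rw [div_pow, Real.sq_sqrt (by norm_num : (0 : ℝ) ≤ 3)]
    field_simp
    ring
  rw [e, Real.sqrt_sq (by positivity)]
  field_simp

/-- `exp(1/2) < 1.648722`. [folklore numerics, from `Real.exp_one_lt_d9`] -/
theorem exp_half_lt : Real.exp (1 / 2) < 1.648722 := by
  by_contra h
  push Not at h
  have h2 : (1.648722 : ℝ) ^ 2 ≤ Real.exp (1 / 2) ^ 2 := pow_le_pow_left₀ (by norm_num) h 2
  have h3 : Real.exp (1 / 2) ^ 2 = Real.exp 1 := by
    rw [← Real.exp_nat_mul]; norm_num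
  have h4 := Real.exp_one_lt_d9
  nlinarith

/-- `1.6487 < exp(1/2)`. [folklore numerics, from `Real.exp_one_gt_d9`] -/
theorem lt_exp_half : (1.6487 : ℝ) < Real.exp (1 / 2) := by
  by_contra h
  push Not at h
  have h2 : Real.exp (1 / 2) ^ 2 ≤ (1.6487 : ℝ) ^ 2 := pow_le_pow_left₀ (Real.exp_pos _).le h 2
  have h3 : Real.exp (1 / 2) ^ 2 = Real.exp 1 := by
    rw [← Real.exp_nat_mul]; norm_num
  have h4 := Real.exp_one_gt_d9
  nlinarith

/-- `sinh(1/2) < 0.5211`. [folklore numerics] -/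
theorem sinh_half_lt : Real.sinh (1 / 2) < 0.5211 := by
  rw [Real.sinh_eq]
  have h1 := exp_half_lt
  have h2 := lt_exp_half
  have h3 : Real.exp (-(1 / 2 : ℝ)) = (Real.exp (1 / 2))⁻¹ := Real.exp_neg _
  have h4 : (1.6487 : ℝ)⁻¹ ≥ (Real.exp (1 / 2))⁻¹ := by
    exact inv_anti₀ (by norm_num) h2.le
  have h5 : (0.6065 : ℝ) ≤ (1.648722 : ℝ)⁻¹ := by norm_num
  have h6 : (1.648722 : ℝ)⁻¹ ≤ (Real.exp (1 / 2))⁻¹ := inv_anti₀ (Real.exp_pos _) h1.le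
  rw [h3]
  linarith

/-- **RACE MARGIN AT `θ = 1`.** With flat clocks (`c̄ = 1`), the junk amplitude allowed by (JB),
`A = √(2·junkThreshold ε)·σ`, and `θ = 1`, the transport-minus-flux part of the co-moving rate is
`σ − 2(1+ε)·(A·sinh(1/2)) = σ·(1 − √3·sinh(1/2)) ≥ 0.097·σ` (`σ ≥ 0`, `ε > −1`): positive, thin.
[cite: Tao2016AveragedNS, §4 (4.3); route TaoLadderRungTwoFlat, L8b / (K2) (LADDER §49.4, HOP-INVARIANT-50 §4)] -/
theorem race_margin_at_one {ε σ : ℝ} (hε : -1 < ε) (hσ : 0 ≤ σ) :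
    0.097 * σ ≤ σ * 1 - 2 * (1 + ε) * 1 * ((Real.sqrt (2 * junkThreshold ε) * σ) * Real.sinh (1 / 2)) := by
  have e : σ * 1 - 2 * (1 + ε) * 1 * ((Real.sqrt (2 * junkThreshold ε) * σ) * Real.sinh (1 / 2))
      = σ * (1 - (2 * (1 + ε) * Real.sqrt (2 * junkThreshold ε)) * Real.sinh (1 / 2)) := by ring
  rw [e, two_mul_sqrt_junkThreshold hε]
  have hs := sinh_half_lt
  have hs0 : 0 ≤ Real.sinh (1 / 2) := Real.sinh_nonneg_iff.mpr (by norm_num)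
  have h3 : Real.sqrt 3 < 1.7321 := by
    rw [show (1.7321 : ℝ) = Real.sqrt (1.7321 ^ 2) by rw [Real.sqrt_sq (by norm_num)]]
    exact Real.sqrt_lt_sqrt (by norm_num) (by norm_num)
  have h3' : 0 ≤ Real.sqrt 3 := Real.sqrt_nonneg _
  have hprod : Real.sqrt 3 * Real.sinh (1 / 2) ≤ 1.7321 * 0.5211 := by
    exact mul_le_mul h3.le hs.le hs0 (by norm_num)
  have hkey : (0.097 : ℝ) ≤ 1 - Real.sqrt 3 * Real.sinh (1 / 2) := by
    have : (1.7321 : ℝ) * 0.5211 ≤ 1 - 0.097 := by norm_num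
    linarith
  calc 0.097 * σ = σ * 0.097 := by ring
    _ ≤ σ * (1 - Real.sqrt 3 * Real.sinh (1 / 2)) := mul_le_mul_of_nonneg_left hkey hσ

end MirrorPulse

end Summit.NavierStokesRegularity.NavierStokesRegularity.Theorems

end
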